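/-
Origin: expansion seat `planner-pub-hodgecm-pv10-0`, handover #18 2026-08-18T04:57:39Z (`HOME/pub-hodgecm-pv10/lean/Pv10/PrincipalIdelesDiscrete.lean`, md5 8d5ce384, 158 lines);
landed by the gen-6 packager in gate run 22 as `HodgeCM/PerL34/PrincipalIdelesDiscrete.lean` (import ^import Pv[0-9]+\.→import HodgeCM.PerL34. ×1).
-/
/-
# `K^×` is discrete — hence closed — in `𝔸_Kˣ`; `C_K` is Hausdorff (kernel)

WIP module `Pv10.PrincipalIdelesDiscrete` (pub-hodgecm-pv10); intended landing
`HodgeCM/PerL34/PrincipalIdelesDiscrete.lean`.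

This DISCHARGES, in the kernel and from Mathlib alone, the PRINT target `PrincipalIdelesClosed K` of
`IdeleTopology.lean` (Neukirch, *Algebraic Number Theory* VI (1.5): "`K^*` is a discrete, and therefore
closed, subgroup of `I_K`", PDF p. 322; Cassels–Fröhlich Ch. II §16 LEMMA, PDF p. 119), by the textbook
argument: the open set `U = {x ∈ 𝔸_Kˣ : x_v ∈ 𝒪_v (v ∤ ∞), ‖x_w − 1‖_w < 1 (w ∣ ∞)}` meets `K^×` only in
`1` — an element `k ∈ K^× ∩ U` is an algebraic integer (`mem_integers_of_valuation_le_one`) with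
`|σ(k − 1)| < 1` for every embedding, so `N(k − 1) ∈ ℤ` has absolute value `< 1`, i.e. `k = 1`
(`InfinitePlace.prod_eq_abs_norm`, `Algebra.coe_norm_int`).  Consequences:
`instDiscreteTopologyPrincipalIdeles`, `principalIdelesClosed`, and the INSTANCE
`T2Space (IdeleClassGroup K)` — one of the two instance hypotheses of
`ProperCriterion.isProperMap_of_comp_factor` at `C := C_L` (N15, PerL v5 tex ll. 310–311) is thereby
unconditional.  No PerL/QW8/2001 statement is used.
-/
import Summits.HodgeConjecture.HodgeCM.PerL34.IdeleTopology
import Mathlib.NumberTheory.NumberField.Norm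
import Mathlib.Topology.Algebra.IsUniformGroup.Basic

set_option autoImplicit false

noncomputable section

open Topology Set

namespace NumberField

open IsDedekindDomain InfinitePlace
open scoped RestrictedProduct

variable (K : Type*) [Field K] [NumberField K]

/-! ## The arithmetic input: a "small integral" element is zero -/

/-- An element of `K` which is integral at every finite place and has absolute value `< 1` at every
infinite place is `0` (its norm would be a nonzero integer of absolute value `< 1`). -/
theorem eq_zero_of_valuation_le_one_of_forall_lt_one (x : K)
    (hfin : ∀ v : HeightOneSpectrum (𝓞 K), v.valuation K x ≤ 1)
    (hinf : ∀ w : InfinitePlace K, w x < 1) : x = 0 := by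
  by_contra hx
  obtain ⟨y, rfl⟩ := HeightOneSpectrum.mem_integers_of_valuation_le_one (R := 𝓞 K) K x hfin
  have hy : y ≠ 0 := by
    rintro rfl
    exact hx (map_zero _)
  -- `1 ≤ |N(y)|`
  have hN : (1 : ℚ) ≤ |Algebra.norm ℚ (y : K)| := by
    rw [← Algebra.coe_norm_int, ← Int.cast_abs]
    exact_mod_cast Int.one_le_abs (Algebra.norm_ne_zero_iff.mpr hy)
  have hN' : (1 : ℝ) ≤ ((|Algebra.norm ℚ (y : K)| : ℚ) : ℝ) := by exact_mod_cast hN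
  -- `|N(y)| = ∏_w w(y)^{mult w} < 1`
  have hprod : ∏ w : InfinitePlace K, w (y : K) ^ mult w < 1 := by
    calc ∏ w : InfinitePlace K, w (y : K) ^ mult w
        < ∏ _w : InfinitePlace K, (1 : ℝ) :=
          Finset.prod_lt_prod_of_nonempty
            (fun w _ => pow_pos (InfinitePlace.pos_iff.mpr hx) _)
            (fun w _ => pow_lt_one₀ (apply_nonneg w _) (hinf w) mult_ne_zero)
            Finset.univ_nonempty
      _ = 1 := Finset.prod_const_one
  rw [prod_eq_abs_norm] at hprod
  exact absurd (hN'.trans_lt hprod) (lt_irrefl _)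

/-! ## The separating open set -/

/-- `U = {x ∈ 𝔸_Kˣ : x_v ∈ 𝒪_v for all finite v, ‖x_w − 1‖ < 1 for all infinite w}`. -/
def unitNeighborhood : Set (ideleGroup K) :=
  {x | (∀ w : InfinitePlace K, ‖(x : AdeleRing (𝓞 K) K).1 w - 1‖ < 1) ∧
    ∀ v : HeightOneSpectrum (𝓞 K), (x : AdeleRing (𝓞 K) K).2 v ∈ v.adicCompletionIntegers K}

/-- (Ported verbatim from the HodgeCMPerL package; no docstring in the source.) -/
theorem isOpen_unitNeighborhood : IsOpen (unitNeighborhood K) := by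
  refine IsOpen.inter ?_ ?_
  · have hS : IsOpen {a : InfiniteAdeleRing K | ∀ w : InfinitePlace K, ‖a w - 1‖ < 1} := by
      have : {a : InfiniteAdeleRing K | ∀ w : InfinitePlace K, ‖a w - 1‖ < 1} =
          ⋂ w : InfinitePlace K, {a : InfiniteAdeleRing K | ‖a w - 1‖ < 1} := by
        ext a; simp
      rw [this]
      exact isOpen_iInter_of_finite fun w =>
        isOpen_lt (((continuous_apply w).sub continuous_const).norm) continuous_const
    exact hS.preimage (continuous_fst.comp Units.continuous_val)
  · exact (RestrictedProduct.isOpen_forall_mem fun v => Valued.isOpen_valuationSubring _).preimage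
      (continuous_snd.comp Units.continuous_val)

/-- (Ported verbatim from the HodgeCMPerL package; no docstring in the source.) -/
theorem one_mem_unitNeighborhood : (1 : ideleGroup K) ∈ unitNeighborhood K := by
  refine ⟨fun w => ?_, fun v => ?_⟩
  · change ‖(1 : w.Completion) - 1‖ < 1
    rw [sub_self, norm_zero]
    exact zero_lt_one
  · change (1 : v.adicCompletion K) ∈ v.adicCompletionIntegers K
    exact one_mem _

omit [NumberField K] in
/-- (Ported verbatim from the HodgeCMPerL package; no docstring in the source.) -/
private theorem norm_algebraMap_infinitePlace (x : K) (w : InfinitePlace K) :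
    ‖(algebraMap K (InfiniteAdeleRing K) x) w‖ = w x := by
  rw [InfiniteAdeleRing.algebraMap_apply]
  have h := NumberField.InfinitePlace.Completion.norm_coe (v := w) ((WithAbs.equiv w.1).symm x)
  rw [RingEquiv.apply_symm_apply] at h
  exact h

/-- `U ∩ K^× = {1}`: a principal idele in `U` is trivial. -/
theorem eq_one_of_mem_principalIdeles_of_mem_unitNeighborhood {x : ideleGroup K}
    (hx : x ∈ principalIdeles K) (hU : x ∈ unitNeighborhood K) : x = 1 := by
  obtain ⟨k, rfl⟩ := hx
  obtain ⟨hinf, hfin⟩ := hU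
  -- the idele of `k` has components `k`
  have h1 : ((Units.map (algebraMap K (AdeleRing (𝓞 K) K) : K →* AdeleRing (𝓞 K) K) k :
      ideleGroup K) : AdeleRing (𝓞 K) K) = algebraMap K (AdeleRing (𝓞 K) K) k := rfl
  have hk : (k : K) - 1 = 0 := by
    refine eq_zero_of_valuation_le_one_of_forall_lt_one K _ (fun v => ?_) (fun w => ?_)
    · -- finite places: `k ∈ 𝒪_v`, so `v(k - 1) ≤ max (v k) (v 1) ≤ 1`
      have hv := hfin v
      rw [h1, AdeleRing.algebraMap_snd_apply, HeightOneSpectrum.mem_adicCompletionIntegers,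
        HeightOneSpectrum.valuedAdicCompletion_eq_valuation'] at hv
      calc v.valuation K ((k : K) - 1) ≤ max (v.valuation K (k : K)) (v.valuation K 1) :=
            Valuation.map_sub _ _ _
        _ ≤ 1 := max_le hv (by rw [map_one])
    · -- infinite places: `‖k - 1‖_w < 1`
      have hw := hinf w
      rw [h1, AdeleRing.algebraMap_fst_apply] at hw
      have e : (algebraMap K (InfiniteAdeleRing K) ((k : K) - 1)) w = ((k : K) : w.Completion) - 1 := by
        rw [map_sub, map_one]; rfl
      rw [← norm_algebraMap_infinitePlace K ((k : K) - 1) w, e]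
      exact hw
  have hk1 : k = 1 := Units.ext (sub_eq_zero.mp hk)
  rw [hk1, map_one]

/-! ## Discreteness, closedness, Hausdorffness -/

/-- **Neukirch VI (1.5), kernel:** the principal ideles form a discrete subgroup of `𝔸_Kˣ`. -/
instance instDiscreteTopologyPrincipalIdeles : DiscreteTopology (principalIdeles K) := by
  refine discreteTopology_of_isOpen_singleton_one ?_
  have : ({1} : Set (principalIdeles K)) = Subtype.val ⁻¹' unitNeighborhood K := by
    ext ⟨x, hx⟩
    simp only [mem_singleton_iff, mem_preimage]
    constructor
    · rintro h
      rw [Subtype.ext_iff] at h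
      change x = 1 at h
      rw [h]
      exact one_mem_unitNeighborhood K
    · intro h
      exact Subtype.ext (eq_one_of_mem_principalIdeles_of_mem_unitNeighborhood K hx h)
  rw [this]
  exact (isOpen_unitNeighborhood K).preimage continuous_subtype_val

/-- `K^×` is closed in `𝔸_Kˣ` — the PRINT target `PrincipalIdelesClosed K` of `IdeleTopology.lean`,
now a theorem. -/
theorem principalIdelesClosed : PrincipalIdelesClosed K :=
  Subgroup.isClosed_of_discrete

/-- **`C_K` is Hausdorff**, unconditionally. -/
instance instT2SpaceIdeleClassGroup : T2Space (IdeleClassGroup K) :=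
  t2Space_ideleClassGroup K (principalIdelesClosed K)

end NumberField

end
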